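import Literature.AnabelianGeometry.AbsoluteAnabelian.AbsTopICharacterRankSplitModel
import Literature.AnabelianGeometry.AbsoluteAnabelian.AbsTopICharacterRankProofs
import Literature.AnabelianGeometry.AbsoluteAnabelian.AbsTopICharacterRankLem45iiiInvariance
import Literature.AnabelianGeometry.AbsoluteAnabelian.AbsTopICuspidalDecompositionSubDualProofs
import HarnessLib

/-!
# [AbsTopI] Lemma 4.5 (ii)/(iii) — the weight calculus of [CombGC] §2 for GENERAL `ℚ_l[G]`-modules:
# quasi-toral modules, finiteness of the associated weights, and duality symmetry

Proof-only companion of `AbsTopICharacterRank.lean` (S. Mochizuki, *Topics in Absolute Anabelian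
Geometry I: Generalities* [MochizukiAbsTopI2012], Lemma 4.5 (ii)(iii), kurims manuscript p. 54) and of
the sub-DAG statements `AbsTopICuspidalDecompositionSub.lean` ([CombGC] = [MochizukiCombGC2007],
S. Mochizuki, *A combinatorial version of the Grothendieck conjecture*, Tohoku Math. J. 59 (2007), kurims
manuscript `paper:url-6994f81053dc`: Def. 2.3 p. 18, Prop. 2.4 + proof pp. 19–20, Prop. 1.3 p. 9, read on
the page), cell abc-iut, block F, seat abc-iut-f-062 (FACT-LIST schemata F-0222 · F-0223 · F-0224 ·
F-0225).  This file supplies, for ARBITRARY finite-dimensional `G`-modules (no model, no splitting), the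
three pieces of [CombGC] §2 that the printed proof of Prop. 2.4 (vii) / Cor. 2.7 (i) uses silently:

* §1 QUASI-TORAL MODULES (Def. 2.3 (i) "`M(−1)` is quasi-trivial"; Prop. 2.4 (ii) "`M^{cusp} ⊗ ℤ_l` is
  quasi-toral"): if an open subgroup of finite index acts on `M` through the scalar character `χ^{cyclo}`
  then `τ(M((χ^{cyclo})⁻¹)) = dim M`, `τ(M) = 0`, and the only associated weight is `2`
  (`weight_eq_two_of_quasiToral`) — for a NON-DEGENERATE `χ^{cyclo}` (no nonzero power trivial on an
  open subgroup of finite index; automatic when the image of `χ^{cyclo}` is infinite on every open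
  subgroup, e.g. "l-cyclotomically full", Def. 2.3 (ii)).
* §3 FINITENESS "`{0} ∪ w_l(M)` … this [finite] subset" (Prop. 2.4 (vii)): `w_l(M)` is finite for EVERY
  finite-dimensional `M` (`finite_weights`) — by induction on `dim M`: an irreducible module carries at
  most one weight (two scalar characters on a nonzero module agree on an open subgroup of finite index,
  hence have the same weight, §2 = the converse half of Prop. 2.4 (iv), last sentence), and `τ` is
  additive along a proper stable submodule (`quasiTrivialRank_eq_add_of_exact`, Additive file).
* §4 DUALITY (Prop. 1.3 "perfect pairing … `H² ≅ Ẑ^Σ`", as used in the proofs of Prop. 2.4 (vi)(vii):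
  "by Proposition 1.3 … `E′_{G′}` is invariant with respect to `λ ↦ 2 − λ`"): a `G`-equivariant
  nondegenerate `χ^{cyclo}`-valued bilinear pairing `B` on `P` (`B(gp, gq) = χ^{cyclo}(g) B(p, q)`,
  `B(p, ·) = 0 ⇒ p = 0`) identifies `P ≅ P^∨(χ^{cyclo})`, whence the `l`-weight-`w` and `l`-weight-`(2−w)`
  ranks of `P` coincide (`quasiTrivialRank_twist_inv_eq_of_pairing`, via sub-node A10
  `dualRankEq_holds`) and `det(P)² = (χ^{cyclo})^{dim P}` (`detChar_sq_eq_of_pairing`, Mathlib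
  `LinearMap.det_dualMap`).
Sequel: `AbsTopICharacterRankPoincareExtension.lean` (A3/A7/A9 and Lemma 4.5 (iii) for the general
extension `0 → M^{cusp} ⊗ ℚ_l → H^{ab} ⊗ ℚ_l → M_{Ḡ} ⊗ ℚ_l → 0`).  No new definitions.  HONEST FRAMING:
refereed pre-IUT anabelian geometry (linear algebra of `G`-modules); nothing bears on [IUTchIII] Cor. 3.12.
-/

noncomputable section

open scoped Classical

namespace Literature.AnabelianGeometry.AbsoluteAnabelian.AbsTopI

universe u v w w'

section WeightDuality

variable {G : Type u} [Group G] [TopologicalSpace G]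
variable {K : Type v} [Field K]
variable {V : Type w} [AddCommGroup V] [Module K V]
variable {P : Type w'} [AddCommGroup P] [Module K P]

/-! ### §0. Quasi-trivial steps of positive dimension -/

/-- If `τ(M) ≠ 0`, some stable filtration has a quasi-trivial step `N ⊋ N'` of positive dimension
(stable `N' ≤ N` and a vector of `N` outside `N'`). [cite: MochizukiAbsTopI2012, Lemma 4.5 (ii) p.54] -/
theorem exists_isQuasiTrivialStep_of_quasiTrivialRank_ne_zero [FiniteDimensional K V]
    {ρ : G →* (V ≃ₗ[K] V)} (h : quasiTrivialRank ρ ≠ 0) :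
    ∃ N N' : Submodule K V, IsStable ρ N ∧ IsStable ρ N' ∧ N' ≤ N ∧
      IsQuasiTrivialStep ρ N N' ∧ ∃ m ∈ N, m ∉ N' := by
  have hpos : 0 < sSup (Set.range (StableChain.qtDim (ρ := ρ))) := Nat.pos_of_ne_zero h
  have hne : (Set.range (StableChain.qtDim (ρ := ρ))).Nonempty := ⟨_, StableChain.trivial ρ, rfl⟩
  obtain ⟨_, ⟨c, rfl⟩, hc⟩ := exists_lt_of_lt_csSup hne hpos
  obtain ⟨j, hj, hne⟩ := Finset.exists_ne_zero_of_sum_ne_zero hc.ne'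
  have hjl : j < c.length := Finset.mem_range.1 hj
  by_cases hq : IsQuasiTrivialStep ρ (c.term j) (c.term (j + 1))
  · rw [if_pos hq] at hne
    have hlt : ¬ c.term j ≤ c.term (j + 1) := by
      intro hle
      have := Submodule.finrank_mono hle
      omega
    obtain ⟨m, hm, hm'⟩ := SetLike.not_le_iff_exists.1 hlt
    exact ⟨c.term j, c.term (j + 1), c.stable j, c.stable (j + 1), c.step_le j hjl, hq, m, hm, hm'⟩
  · rw [if_neg hq] at hne
    exact absurd rfl hne

/-- In a quasi-trivial step of a twist `M(ψ⁻¹)` of a module on which an open subgroup of finite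
index acts through the scalar character `χ`, the two characters agree on an open subgroup of finite
index: `χ · ψ⁻¹ = 1` there. [cite: MochizukiCombGC2007, Def. 2.3 (i)(ii) p.18] -/
theorem exists_trivialOn_mul_inv_of_scalarOn {ρ : G →* (V ≃ₗ[K] V)} {χ ψ : G →* Kˣ}
    {U₀ : Subgroup G} (hU₀ : IsOpen (U₀ : Set G)) [U₀.FiniteIndex]
    {N N' : Submodule K V} (hact₀ : ∀ g ∈ U₀, ∀ m ∈ N, ρ g m = (χ g : K) • m)
    (hstep : IsQuasiTrivialStep (twist ρ ψ⁻¹) N N') (hm : ∃ m ∈ N, m ∉ N') :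
    ∃ U : Subgroup G, IsOpen (U : Set G) ∧ U.FiniteIndex ∧ ∀ g ∈ U, (χ * ψ⁻¹) g = 1 := by
  obtain ⟨U₁, hU₁, hfi₁, hact₁⟩ := hstep
  obtain ⟨m, hmN, hmN'⟩ := hm
  haveI := hfi₁
  refine ⟨U₀ ⊓ U₁, hU₀.inter hU₁, inferInstance, fun g hg => ?_⟩
  have h1 := hact₁ g hg.2 m hmN
  have ht_eq : ψ⁻¹ g * χ g = (χ * ψ⁻¹) g := by rw [MonoidHom.mul_apply, mul_comm]
  rw [twist_apply, hact₀ g hg.1 m hmN, smul_smul, ← Units.val_mul, ht_eq] at h1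
  -- `(t - 1) • m ∈ N'` with `m ∉ N'` forces `t = 1`
  by_contra ht
  have ht' : (((χ * ψ⁻¹) g : Kˣ) : K) - 1 ≠ 0 := by
    intro h0
    exact ht (Units.val_eq_one.1 (sub_eq_zero.1 h0))
  have h2 : ((((χ * ψ⁻¹) g : Kˣ) : K) - 1) • m ∈ N' := by rwa [sub_smul, one_smul]
  have h3 := N'.smul_mem ((((χ * ψ⁻¹) g : Kˣ) : K) - 1)⁻¹ h2
  rw [smul_smul, inv_mul_cancel₀ ht', one_smul] at h3
  exact hmN' h3

/-! ### §1. A quasi-toral module: an open subgroup of finite index acts through `χ^{cyclo}`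
([CombGC] Def. 2.3 (i) "quasi-toral": `M(−1)` is quasi-trivial; Prop. 2.4 (ii): `M^{cusp} ⊗ ℤ_l` is quasi-toral) -/

/-- On a quasi-toral module, a twist `M(ψ⁻¹)` with `τ ≠ 0` forces `ψ = χ^{cyclo}` on an open subgroup of
finite index. [cite: MochizukiCombGC2007, Prop. 2.4 (ii) p.19] -/
theorem exists_trivialOn_of_quasiToral [FiniteDimensional K V] {ρ : G →* (V ≃ₗ[K] V)} {χ : G →* Kˣ}
    (hρ : ∃ U : Subgroup G, IsOpen (U : Set G) ∧ U.FiniteIndex ∧ ∀ g ∈ U, ∀ m : V, ρ g m = (χ g : K) • m)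
    {ψ : G →* Kˣ} (h : quasiTrivialRank (twist ρ ψ⁻¹) ≠ 0) :
    ∃ U : Subgroup G, IsOpen (U : Set G) ∧ U.FiniteIndex ∧ ∀ g ∈ U, (χ * ψ⁻¹) g = 1 := by
  obtain ⟨U₀, hU₀, hfi₀, hact₀⟩ := hρ
  haveI := hfi₀
  obtain ⟨N, N', -, -, -, hstep, hm⟩ := exists_isQuasiTrivialStep_of_quasiTrivialRank_ne_zero h
  exact exists_trivialOn_mul_inv_of_scalarOn hU₀ (fun g hg m _ => hact₀ g hg m) hstep hm

/-- `τ(M((χ^{cyclo})⁻¹)) = dim M` for a quasi-toral `M` (the twisted action is quasi-trivial).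
[cite: MochizukiCombGC2007, Def. 2.3 (i) p.18] -/
theorem quasiTrivialRank_twist_inv_of_quasiToral [FiniteDimensional K V] {ρ : G →* (V ≃ₗ[K] V)}
    {χ : G →* Kˣ}
    (hρ : ∃ U : Subgroup G, IsOpen (U : Set G) ∧ U.FiniteIndex ∧ ∀ g ∈ U, ∀ m : V, ρ g m = (χ g : K) • m) :
    quasiTrivialRank (twist ρ χ⁻¹) = Module.finrank K V := by
  obtain ⟨U₀, hU₀, hfi₀, hact₀⟩ := hρ
  refine quasiTrivialRank_eq_finrank_of_quasiTrivial _ ⟨U₀, hU₀, hfi₀, fun g hg => ?_⟩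
  ext m
  rw [twist_apply, hact₀ g hg m, smul_smul, MonoidHom.inv_apply, ← Units.val_mul, inv_mul_cancel,
    Units.val_one, one_smul, LinearEquiv.coe_one, id_eq]

/-- For a NON-DEGENERATE `χ^{cyclo}` (no nonzero power trivial on an open subgroup of finite index), a
quasi-toral module has `τ(M) = 0` (weight `2 ≠ 0`). [cite: MochizukiCombGC2007, Prop. 2.4 (ii) p.19] -/
theorem quasiTrivialRank_of_quasiToral [FiniteDimensional K V] {ρ : G →* (V ≃ₗ[K] V)} {χ : G →* Kˣ}
    (hcyc : ∀ U : Subgroup G, IsOpen (U : Set G) → U.FiniteIndex →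
      ∀ a : ℤ, a ≠ 0 → ∃ g ∈ U, χ g ^ a ≠ 1)
    (hρ : ∃ U : Subgroup G, IsOpen (U : Set G) ∧ U.FiniteIndex ∧ ∀ g ∈ U, ∀ m : V, ρ g m = (χ g : K) • m) :
    quasiTrivialRank ρ = 0 := by
  by_contra h
  have e1 : (1 : G →* Kˣ)⁻¹ = 1 := by ext g; simp
  have h' : quasiTrivialRank (twist ρ (1 : G →* Kˣ)⁻¹) ≠ 0 := by rwa [e1, twist_one]
  obtain ⟨U, hU, hfi, hact⟩ := exists_trivialOn_of_quasiToral hρ h'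
  refine not_trivialOn_of_nondegenerate χ hcyc ⟨U, hU, hfi, fun g hg => ?_⟩
  simpa using hact g hg

/-- The only weight of a quasi-toral module is `2`: a `ℚ`-cyclotomic `ψ` of weight `w` with
`τ(M(ψ⁻¹)) ≠ 0` has `w = 2` (non-degenerate `χ^{cyclo}`). [cite: MochizukiCombGC2007, Prop. 2.4 (ii) p.19] -/
theorem weight_eq_two_of_quasiToral [FiniteDimensional K V] {ρ : G →* (V ≃ₗ[K] V)} {χ : G →* Kˣ}
    (hcyc : ∀ U : Subgroup G, IsOpen (U : Set G) → U.FiniteIndex →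
      ∀ a : ℤ, a ≠ 0 → ∃ g ∈ U, χ g ^ a ≠ 1)
    (hρ : ∃ U : Subgroup G, IsOpen (U : Set G) ∧ U.FiniteIndex ∧ ∀ g ∈ U, ∀ m : V, ρ g m = (χ g : K) • m)
    {ψ : G →* Kˣ} {w : ℚ} (hψ : IsQCyclotomicOfWeightK χ ψ w)
    (h : quasiTrivialRank (twist ρ ψ⁻¹) ≠ 0) : w = 2 :=
  weight_eq_two_of_trivialOn_mul_inv hcyc hψ (exists_trivialOn_of_quasiToral hρ h)

/-! ### §2. `ℚ`-cyclotomic characters agreeing on an open subgroup of finite index have the same weight -/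

/-- Two `ℚ`-cyclotomic characters that coincide on an open subgroup of finite index have the same
weight (non-degenerate `χ^{cyclo}`): `(χ^{cyclo})^{a₁b₂} = ψ₁^{b₁b₂} = ψ₂^{b₁b₂} = (χ^{cyclo})^{a₂b₁}`
there. (Converse direction of [CombGC] Prop. 2.4 (iv), last sentence.)
[cite: MochizukiCombGC2007, Prop. 2.4 (iv) p.19] [cite: MochizukiCombGC2007, Def. 2.3 (ii) p.18] -/
theorem weight_eq_of_eqOn {χ ψ₁ ψ₂ : G →* Kˣ} {w₁ w₂ : ℚ}
    (hcyc : ∀ U : Subgroup G, IsOpen (U : Set G) → U.FiniteIndex →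
      ∀ a : ℤ, a ≠ 0 → ∃ g ∈ U, χ g ^ a ≠ 1)
    (h₁ : IsQCyclotomicOfWeightK χ ψ₁ w₁) (h₂ : IsQCyclotomicOfWeightK χ ψ₂ w₂)
    (hU : ∃ U : Subgroup G, IsOpen (U : Set G) ∧ U.FiniteIndex ∧ ∀ g ∈ U, ψ₁ g = ψ₂ g) : w₁ = w₂ := by
  obtain ⟨a₁, b₁, hb₁, e₁, hw₁⟩ := h₁
  obtain ⟨a₂, b₂, hb₂, e₂, hw₂⟩ := h₂
  obtain ⟨U, hUo, hfi, hact⟩ := hU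
  have hab : a₁ * b₂ = a₂ * b₁ := by
    by_contra hne
    obtain ⟨g, hg, hg1⟩ := hcyc U hUo hfi (a₁ * b₂ - a₂ * b₁) (sub_ne_zero.2 hne)
    apply hg1
    have k₁ : χ g ^ (a₁ * b₂) = ψ₁ g ^ (b₁ * b₂) := by rw [zpow_mul, ← e₁ g, ← zpow_mul]
    have k₂ : χ g ^ (a₂ * b₁) = ψ₁ g ^ (b₁ * b₂) := by
      rw [zpow_mul, ← e₂ g, ← hact g hg, ← zpow_mul, mul_comm b₂ b₁]
    rw [zpow_sub, k₁, k₂, mul_inv_cancel]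
  have hb₁' : (b₁ : ℚ) ≠ 0 := by exact_mod_cast hb₁.ne'
  have hb₂' : (b₂ : ℚ) ≠ 0 := by exact_mod_cast hb₂.ne'
  rw [hw₁, hw₂, div_eq_div_iff hb₁' hb₂']
  have : ((a₁ * b₂ : ℤ) : ℚ) = ((a₂ * b₁ : ℤ) : ℚ) := by rw [hab]
  push_cast at this
  linarith

/-! ### §3. Finiteness of the set of associated weights `w_l(M)` ([CombGC] Prop. 2.4 (vii): "[finite]") -/

/-- In a module whose only stable submodules are `0` and itself, `τ(M(ψ⁻¹)) ≠ 0` means an open subgroup of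
finite index acts on `M` through the scalar character `ψ`. [cite: MochizukiCombGC2007, Def. 2.3 (i) p.18] -/
theorem exists_scalarOn_of_irreducible [FiniteDimensional K V] {ρ : G →* (V ≃ₗ[K] V)}
    (hirr : ∀ N : Submodule K V, IsStable ρ N → N ≠ ⊥ → N = ⊤) {ψ : G →* Kˣ}
    (h : quasiTrivialRank (twist ρ ψ⁻¹) ≠ 0) :
    ∃ U : Subgroup G, IsOpen (U : Set G) ∧ U.FiniteIndex ∧ ∀ g ∈ U, ∀ m : V, ρ g m = (ψ g : K) • m := by
  obtain ⟨N, N', hN, hN', hle, ⟨U, hU, hfi, hact⟩, m, hmN, hmN'⟩ :=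
    exists_isQuasiTrivialStep_of_quasiTrivialRank_ne_zero h
  rw [isStable_twist_iff] at hN hN'
  have hN'bot : N' = ⊥ := by
    by_contra hne
    have := hirr N' hN' hne
    exact hmN' (this ▸ Submodule.mem_top)
  have hNtop : N = ⊤ := by
    refine hirr N hN ?_
    rintro rfl
    rw [Submodule.mem_bot] at hmN
    apply hmN'
    rw [hmN]
    exact N'.zero_mem
  subst hN'bot hNtop
  refine ⟨U, hU, hfi, fun g hg m => ?_⟩
  have h1 := hact g hg m Submodule.mem_top
  rw [Submodule.mem_bot, sub_eq_zero, twist_apply, MonoidHom.inv_apply, Units.val_inv_eq_inv_val] at h1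
  have h2 := congrArg (fun x => (ψ g : K) • x) h1
  simp only [smul_smul, mul_inv_cancel₀ (ψ g).ne_zero, one_smul] at h2
  exact h2

/-- **`w_l(M)` is finite** for every finite-dimensional `G`-module `M` (non-degenerate `χ^{cyclo}`): by
induction on `dim M` — an irreducible module has at most one associated weight (two scalar characters
on one nonzero module agree on an open subgroup of finite index, §2), and otherwise `τ` is additive
along a proper stable submodule ([AbsTopI] Lemma 4.5 (ii), `quasiTrivialRank_eq_add_of_exact`), so
`w_l(M) ⊆ w_l(N) ∪ w_l(M/N)`. [cite: MochizukiCombGC2007, Prop. 2.4 (vii) p.20]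
[cite: MochizukiCombGC2007, Def. 2.3 (ii) p.18] -/
theorem finite_weights_of_finrank_eq {χ : G →* Kˣ}
    (hcyc : ∀ U : Subgroup G, IsOpen (U : Set G) → U.FiniteIndex →
      ∀ a : ℤ, a ≠ 0 → ∃ g ∈ U, χ g ^ a ≠ 1) :
    ∀ (n : ℕ) {M : Type w} [AddCommGroup M] [Module K M] [FiniteDimensional K M]
      (ρ : G →* (M ≃ₗ[K] M)), Module.finrank K M = n →
      {w : ℚ | ∃ ψ : G →* Kˣ, IsQCyclotomicOfWeightK χ ψ w ∧ quasiTrivialRank (twist ρ ψ⁻¹) ≠ 0}.Finite := by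
  intro n
  induction n using Nat.strong_induction_on with
  | _ n IH =>
  intro M _ _ _ ρ hn
  by_cases hred : ∃ N : Submodule K M, IsStable ρ N ∧ N ≠ ⊥ ∧ N ≠ ⊤
  · -- split along a proper nonzero stable submodule
    obtain ⟨N, hN, hNbot, hNtop⟩ := hred
    obtain ⟨ρN, hρN⟩ := exists_subrepresentation ρ hN
    obtain ⟨ρQ, hρQ⟩ := exists_quotientRepresentation ρ hN
    have hdimN : Module.finrank K N < n := hn ▸ Submodule.finrank_lt hNtop
    have hdimQ : Module.finrank K (M ⧸ N) < n := by
      have h1 := N.finrank_quotient_add_finrank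
      have h2 : Module.finrank K N ≠ 0 := fun h0 => hNbot (Submodule.finrank_eq_zero.1 h0)
      omega
    have hfinN := IH _ hdimN ρN rfl
    have hfinQ := IH _ hdimQ ρQ rfl
    refine (hfinN.union hfinQ).subset ?_
    rintro w ⟨ψ, hψ, hne⟩
    have hadd := quasiTrivialRank_eq_add_of_exact (twist ρ ψ⁻¹) ((isStable_twist_iff ρ ψ⁻¹ N).2 hN)
      (twist ρN ψ⁻¹) (fun g x => by rw [twist_apply, twist_apply, Submodule.coe_smul, hρN])
      (twist ρQ ψ⁻¹) (fun g m => by rw [twist_apply, twist_apply, hρQ, map_smul])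
    rw [hadd] at hne
    by_cases hN0 : quasiTrivialRank (twist ρN ψ⁻¹) = 0
    · rw [hN0, zero_add] at hne
      exact Or.inr ⟨ψ, hψ, hne⟩
    · exact Or.inl ⟨ψ, hψ, hN0⟩
  · -- irreducible (or zero): at most one weight
    push Not at hred
    have hirr : ∀ N : Submodule K M, IsStable ρ N → N ≠ ⊥ → N = ⊤ := fun N hN hb => hred N hN hb
    refine Set.Subsingleton.finite ?_
    rintro w₁ ⟨ψ₁, hψ₁, h₁⟩ w₂ ⟨ψ₂, hψ₂, h₂⟩
    obtain ⟨U₁, hU₁, hfi₁, hact₁⟩ := exists_scalarOn_of_irreducible hirr h₁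
    obtain ⟨U₂, hU₂, hfi₂, hact₂⟩ := exists_scalarOn_of_irreducible hirr h₂
    -- a nonzero vector exists since `τ ≠ 0` forces `M ≠ 0`
    have hM : ∃ m : M, m ≠ 0 := by
      by_contra h0
      push Not at h0
      apply h₁
      haveI : Subsingleton M := ⟨fun a b => by rw [h0 a, h0 b]⟩
      have : Module.finrank K M = 0 := Module.finrank_zero_of_subsingleton
      have := quasiTrivialRank_le_finrank (twist ρ ψ₁⁻¹)
      omega
    obtain ⟨m, hm⟩ := hM
    haveI := hfi₁
    haveI := hfi₂
    refine weight_eq_of_eqOn hcyc hψ₁ hψ₂ ⟨U₁ ⊓ U₂, hU₁.inter hU₂, inferInstance, fun g hg => ?_⟩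
    have key : ((ψ₁ g : K) - (ψ₂ g : K)) • m = 0 := by
      rw [sub_smul, ← hact₁ g hg.1 m, ← hact₂ g hg.2 m, sub_self]
    rcases smul_eq_zero.1 key with h0 | h0
    · exact Units.ext (sub_eq_zero.1 h0)
    · exact absurd h0 hm

/-- **`w_l(M)` is finite** (packaged). [cite: MochizukiCombGC2007, Prop. 2.4 (vii) p.20] -/
theorem finite_weights [FiniteDimensional K V] {χ : G →* Kˣ}
    (hcyc : ∀ U : Subgroup G, IsOpen (U : Set G) → U.FiniteIndex →
      ∀ a : ℤ, a ≠ 0 → ∃ g ∈ U, χ g ^ a ≠ 1) (ρ : G →* (V ≃ₗ[K] V)) :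
    {w : ℚ | ∃ ψ : G →* Kˣ, IsQCyclotomicOfWeightK χ ψ w ∧ quasiTrivialRank (twist ρ ψ⁻¹) ≠ 0}.Finite :=
  finite_weights_of_finrank_eq hcyc _ ρ rfl

/-! ### §4. Poincaré duality: a `G`-equivariant nondegenerate `χ^{cyclo}`-valued pairing on `P`
([CombGC] Prop. 1.3: the cup product `H¹ × H¹ → H² ≅ Ẑ^Σ(1)` is a perfect pairing on `M_G`) -/

omit [TopologicalSpace G] in
/-- Twisting the dual: `Hom(M(φ⁻¹), K) = Hom(M, K)(φ)`. [cite: MochizukiAbsTopI2012, Lemma 4.5 (ii) p.54] -/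
theorem dualRep_twist (ρ : G →* (P ≃ₗ[K] P)) (φ : G →* Kˣ) :
    dualRep (twist ρ φ⁻¹) = twist (dualRep ρ) φ := by
  ext g f x
  have hφ : φ⁻¹ g⁻¹ = φ g := by rw [MonoidHom.inv_apply, map_inv, inv_inv]
  rw [dualRep_apply, twist_apply, twist_apply, LinearMap.smul_apply, dualRep_apply, map_smul, hφ]

omit [TopologicalSpace G] in
/-- The `ψ⁻¹`-twist of `χ^{cyclo} · ψ⁻¹` has weight `2 − w` if `ψ` has weight `w`
(`(χψ⁻¹)^b = χ^{b−a}`). [cite: MochizukiCombGC2007, Def. 2.3 (ii) p.18] -/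
theorem isQCyclotomicOfWeightK_cyclo_mul_inv {χ ψ : G →* Kˣ} {w : ℚ}
    (h : IsQCyclotomicOfWeightK χ ψ w) : IsQCyclotomicOfWeightK χ (χ * ψ⁻¹) (2 - w) := by
  obtain ⟨a, b, hb, e, hw⟩ := h
  refine ⟨b - a, b, hb, fun g => ?_, ?_⟩
  · rw [MonoidHom.mul_apply, MonoidHom.inv_apply, mul_zpow, inv_zpow, e g, ← zpow_sub]
  · rw [hw]
    have hbq : (b : ℚ) ≠ 0 := by exact_mod_cast hb.ne'
    push_cast
    field_simp

omit [TopologicalSpace G] in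
/-- **A nondegenerate `G`-equivariant `χ^{cyclo}`-valued pairing `B` identifies `P` with `P^∨(χ^{cyclo})`**
(`p ↦ B(p, ·)`, an injective linear map between spaces of the same finite dimension, intertwining
`ρ` with the `χ^{cyclo}`-twisted dual action). [cite: MochizukiCombGC2007, Prop. 1.3 p.9] -/
theorem exists_equivariant_toDual_of_pairing [FiniteDimensional K P] (ρ : G →* (P ≃ₗ[K] P))
    {χ : G →* Kˣ} (B : P →ₗ[K] P →ₗ[K] K)
    (hB : ∀ (g : G) (p q : P), B (ρ g p) (ρ g q) = (χ g : K) * B p q)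
    (hBl : ∀ p : P, (∀ q : P, B p q = 0) → p = 0) :
    ∃ Φ : P ≃ₗ[K] Module.Dual K P, (∀ p : P, (Φ p : Module.Dual K P) = B p) ∧
      ∀ (g : G) (p : P), Φ (ρ g p) = twist (dualRep ρ) χ g (Φ p) := by
  have hinj : Function.Injective B := by
    rw [← LinearMap.ker_eq_bot, LinearMap.ker_eq_bot']
    intro p hp
    exact hBl p fun q => by rw [hp, LinearMap.zero_apply]
  refine ⟨LinearMap.linearEquivOfInjective B hinj (Subspace.dual_finrank_eq).symm, fun p => rfl,
    fun g p => ?_⟩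
  apply LinearMap.ext
  intro q
  show B (ρ g p) q = ((χ g : K) • dualRep ρ g (B p)) q
  rw [LinearMap.smul_apply, dualRep_apply, smul_eq_mul]
  have hq : ρ g (ρ g⁻¹ q) = q := by
    rw [← LinearEquiv.mul_apply, ← map_mul, mul_inv_cancel, map_one, LinearEquiv.coe_one, id_eq]
  calc B (ρ g p) q = B (ρ g p) (ρ g (ρ g⁻¹ q)) := by rw [hq]
    _ = (χ g : K) * B p (ρ g⁻¹ q) := hB g p _

/-- **Duality symmetry of the weight ranks** ([CombGC] proof of Prop. 2.4 (vi)/(vii): "by Proposition 1.3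
… `E′` is invariant with respect to `λ ↦ 2 − λ`"): under a nondegenerate equivariant `χ^{cyclo}`-valued
pairing, `τ(P(ψ⁻¹)) = τ(P((χ^{cyclo}ψ⁻¹)⁻¹))` for EVERY character `ψ` — the `l`-weight-`w` rank equals
the `l`-weight-`(2 − w)` rank. Proof: `P ≅ P^∨(χ)`, `P^∨(χ)(ψ⁻¹) = (P((χψ⁻¹)⁻¹))^∨`, and
`τ(N^∨) = τ(N)` (sub-node A10, `dualRankEq_holds`). [cite: MochizukiCombGC2007, Prop. 2.4 (vii) p.20]
[cite: MochizukiCombGC2007, Prop. 1.3 p.9] -/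
theorem quasiTrivialRank_twist_inv_eq_of_pairing [FiniteDimensional K P] (ρ : G →* (P ≃ₗ[K] P))
    {χ : G →* Kˣ} (B : P →ₗ[K] P →ₗ[K] K)
    (hB : ∀ (g : G) (p q : P), B (ρ g p) (ρ g q) = (χ g : K) * B p q)
    (hBl : ∀ p : P, (∀ q : P, B p q = 0) → p = 0) (ψ : G →* Kˣ) :
    quasiTrivialRank (twist ρ ψ⁻¹) = quasiTrivialRank (twist ρ (χ * ψ⁻¹)⁻¹) := by
  obtain ⟨Φ, -, he⟩ := exists_equivariant_toDual_of_pairing ρ B hB hBl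
  calc quasiTrivialRank (twist ρ ψ⁻¹)
      = quasiTrivialRank (twist (twist (dualRep ρ) χ) ψ⁻¹) :=
        quasiTrivialRank_eq_of_equivariant Φ (twist_equivariant Φ he ψ⁻¹)
    _ = quasiTrivialRank (dualRep (twist ρ (χ * ψ⁻¹)⁻¹)) := by rw [twist_twist, dualRep_twist]
    _ = quasiTrivialRank (twist ρ (χ * ψ⁻¹)⁻¹) := dualRankEq_holds _

omit [TopologicalSpace G] in
/-- `det(φ(g) · ρ(g)) = φ(g)^{dim P} · det ρ(g)`. [cite: MochizukiAbsTopI2012, Lemma 4.5 (iii) p.54] -/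
theorem detChar_twist [FiniteDimensional K P] (ρ : G →* (P ≃ₗ[K] P)) (φ : G →* Kˣ) (g : G) :
    detChar (twist ρ φ) g = φ g ^ Module.finrank K P * detChar ρ g := by
  apply Units.ext
  have hlin : ((twist ρ φ g : P ≃ₗ[K] P) : P →ₗ[K] P) =
      (φ g : K) • ((ρ g : P ≃ₗ[K] P) : P →ₗ[K] P) := by
    ext m
    rw [LinearEquiv.coe_coe, twist_apply, LinearMap.smul_apply, LinearEquiv.coe_coe]
  show ((LinearEquiv.det (twist ρ φ g) : Kˣ) : K) = ((φ g ^ Module.finrank K P * LinearEquiv.det (ρ g) : Kˣ) : K)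
  rw [LinearEquiv.coe_det, hlin, LinearMap.det_smul, Units.val_mul, Units.val_pow_eq_pow_val,
    LinearEquiv.coe_det]

omit [TopologicalSpace G] in
/-- `det` of the dual action is the inverse: `det((ρ(g⁻¹))ᵗ) = det ρ(g)⁻¹`.
[cite: MochizukiAbsTopI2012, Lemma 4.5 (iii) p.54] -/
theorem detChar_dualRep [FiniteDimensional K P] (ρ : G →* (P ≃ₗ[K] P)) (g : G) :
    detChar (dualRep ρ) g = (detChar ρ g)⁻¹ := by
  rw [← map_inv]
  apply Units.ext
  show ((LinearEquiv.det (dualRep ρ g) : Kˣ) : K) = ((LinearEquiv.det (ρ g⁻¹) : Kˣ) : K)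
  rw [LinearEquiv.coe_det, LinearEquiv.coe_det]
  exact LinearMap.det_dualMap _

omit [TopologicalSpace G] in
/-- **`det(P)² = (χ^{cyclo})^{dim P}`** under a nondegenerate equivariant `χ^{cyclo}`-valued pairing
(`P ≅ P^∨(χ)` gives `det ρ(g) = χ(g)^{dim P} · det ρ(g)⁻¹`) — the compactified part of
[CombGC] Prop. 2.4 (iii). [cite: MochizukiCombGC2007, Prop. 2.4 (iii) p.19] [cite: MochizukiCombGC2007, Prop. 1.3 p.9] -/
theorem detChar_sq_eq_of_pairing [FiniteDimensional K P] (ρ : G →* (P ≃ₗ[K] P))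
    {χ : G →* Kˣ} (B : P →ₗ[K] P →ₗ[K] K)
    (hB : ∀ (g : G) (p q : P), B (ρ g p) (ρ g q) = (χ g : K) * B p q)
    (hBl : ∀ p : P, (∀ q : P, B p q = 0) → p = 0) (g : G) :
    detChar ρ g ^ 2 = χ g ^ Module.finrank K P := by
  obtain ⟨Φ, -, he⟩ := exists_equivariant_toDual_of_pairing ρ B hB hBl
  have h1 := detChar_eq_of_equivariant Φ he
  have h2 : detChar ρ g = χ g ^ Module.finrank K P * (detChar ρ g)⁻¹ := by
    conv_lhs => rw [h1, detChar_twist, detChar_dualRep, Subspace.dual_finrank_eq]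
  calc detChar ρ g ^ 2 = detChar ρ g * detChar ρ g := sq _
    _ = χ g ^ Module.finrank K P * (detChar ρ g)⁻¹ * detChar ρ g := by rw [← h2]
    _ = χ g ^ Module.finrank K P := inv_mul_cancel_right _ _

end WeightDuality

end Literature.AnabelianGeometry.AbsoluteAnabelian.AbsTopI

end
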